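import Literature.IUT.HodgeTheaters.PMBaseBridgePropsProofs5
import HarnessLib

/-!
# [IUTchI] Proposition 6.8 (i): the `𝔽_l^{⋊±}`-symmetry of a `𝒟-Θ^{ell}`-bridge IS the action of the finite
# group `Aut_±(T)`, naturally outer-isomorphic to `𝔽_l^{⋊±}`, doubly transitive on `T` (proof-only)

S. Mochizuki, *Inter-universal Teichmüller theory I*, kurims manuscript (May 2020), §6, Proposition 6.8 (i)
p. 167 l.38 – p. 168 l.8 [claim: Mochizuki2012, status: disputed] (D-0012 claim key; series status
DISPUTED — the content here is `𝔽_l^{⋊±}`-torsor bookkeeping over the §6 base kit; nothing is asserted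
about any disputed step).  Sub-DAG `plan/L5/SUBDAG-IUTchI-Prop67-Prop68i.md` rows P68i-L03 / P68i-L04
(abc-iut-w5-d228): the clause of Prop 6.8 (i) left untyped by abc-iut-L5-t4's named statement
`DThetaPMEllHT.EllBridgeSymmetry` (transitivity on `T` + the count `2·|T|`), namely

  "whose output data admits an `𝔽_l^{⋊±}`-symmetry — i.e., more precisely, a symmetry given by the action
  of a finite group that is equipped with a natural outer isomorphism to `𝔽_l^{⋊±}` — which acts doubly
  transitively [i.e., transitively with stabilizers of order two] on the index set [i.e., `T`] of the
  underlying capsule of `𝒟`-prime-strips [i.e., `†𝔇_T`] of this output data" (p. 168 l.2–8).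

Rendering (no new definition, no new `Prop` fact): the finite group is `Aut_±(T)` — the automorphism
group of the `𝔽_l^±`-torsor `T` (`FlPMTorsor.autPM`, [IUTchI] Def 6.1 (i) p. 155, abc-iut-L5-t1) — and

* `FlPMTorsor.compat_self_iff_mem_autPM`: the self-bijections of `T` compatible with its `𝔽_l^±`-torsor
  structure are exactly the elements of `Aut_±(T)`;
* `DThetaPMEllHT.ellBridgeSymmetryGroup_of_equivariant`: for the underlying `𝒟-Θ^{ell}`-bridge of a
  `𝒟-Θ^{±ell}`-Hodge theater, CONDITIONAL on the same hypothesis `hE` as abc-iut-L5-t13's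
  `ellBridgeSymmetry_of_equivariant` (the `[−1]`-equivariance of Example 6.3 (ii) for negative elements):
  (a) the symmetries (= the isomorphisms `†φ^{Θell}_± ⥲ †φ^{Θell}_±` of Def 6.4 (ii)), read through their
  index bijections, are in BIJECTION with `Aut_±(T)` — the symmetry IS the action of this finite group
  (t13's `DThetaEllBridge.isoTorsor_injective` / `isoTorsor_surjective_of_equivariant`, Prop 6.6 (ii));
  (b) `Aut_±(T)` carries a NATURAL OUTER ISOMORPHISM to `𝔽_l^{⋊±}`: every chart `e` of the torsor reads it
  isomorphically onto `𝔽_l^{⋊±}` (L5-t1's `exists_mulEquiv_autPM`; a change of chart conjugates the reading,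
  `read_conj`, so the isomorphism is canonical exactly up to inner automorphisms);
  (c) the action on `T` is transitive with stabilizers of order two (`autPM_isPretransitive`,
  `card_stabilizer_autPM`).

The composition law of the symmetries themselves is not restated: abc-iut-L5-t4's `DThetaEllBridge.Iso`
carries no composition, and (a) transports the group law of `Aut_±(T)` (author's map, STATUS
2026-08-26T00:17:47Z).  Proof-only file; typed ≠ proved for the `hE`-free statement; no side taken on
[IUTchIII] Cor 3.12.
-/

namespace Literature.IUT.HodgeTheaters

open CategoryTheory

universe u

namespace FlPMTorsor

variable {l : ℕ} {T : Type*} (S : FlPMTorsor l T)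

/-- The self-bijections of an `𝔽_l^±`-torsor `T` that are compatible with its torsor structure (pull
charts back to charts) are exactly the elements of `Aut_±(T)` ([IUTchI] Def 6.1 (i) p. 155: "the group
of automorphisms of the underlying set of `T` determined … by … `𝔽_l^{⋊±}`"; L5-t1's
`existsUnique_autPM_comp` / `isIso_autPM_comp` at `f' = id`). [claim: Mochizuki2012, status: disputed] -/
theorem compat_self_iff_mem_autPM (f : T ≃ T) :
    FlPMTorsor.Compat S S f ↔ (f : Equiv.Perm T) ∈ S.autPM := by
  have h1 : FlPMTorsor.Compat S S (Equiv.refl T) := fun e he => by simpa using he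
  constructor
  · intro hf
    obtain ⟨σ, ⟨hσ, hσf⟩, -⟩ := S.existsUnique_autPM_comp S hf h1
    rw [Equiv.trans_refl] at hσf
    rw [← hσf]
    exact hσ
  · intro hf e he
    simpa using S.isIso_autPM_comp S hf (f := Equiv.refl T) h1 e he

end FlPMTorsor

namespace PMBaseKit

variable {l : ℕ} {K : PMBaseKit.{u} l}

namespace DThetaPMEllHT

/-- The index bijection of a symmetry of the underlying `𝒟-Θ^{ell}`-bridge of a `𝒟-Θ^{±ell}`-Hodge theater is
an element of the finite group `Aut_±(T)` (it is an isomorphism of `𝔽_l^±`-torsors, Def 6.4 (ii)).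
([IUTchI] Prop 6.8 (i) p.168) [claim: Mochizuki2012, status: disputed] -/
theorem ellBridgeIso_indexEquiv_mem_autPM (H : K.DThetaPMEllHT)
    (g : DThetaEllBridge.Iso H.ellBridge H.ellBridge) :
    (g.indexEquiv : Equiv.Perm H.T) ∈ H.grpT.toTorsor.autPM :=
  (H.grpT.toTorsor.compat_self_iff_mem_autPM g.indexEquiv).1 g.indexEquiv_charts

/-- **[IUTchI] Proposition 6.8 (i), the GROUP clause — PROVED conditionally** on the equivariance of
Example 6.3 (ii) for negative elements (t13's hypothesis `hE`, nothing further): for the underlying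
`𝒟-Θ^{ell}`-bridge `†φ^{Θell}_± : †𝔇_T → †𝒟^{⊚±}` of a `𝒟-Θ^{±ell}`-Hodge theater over a base kit with a valuation,
"[the] output data admits an `𝔽_l^{⋊±}`-symmetry — i.e., more precisely, a symmetry given by the action of
a finite group that is equipped with a natural outer isomorphism to `𝔽_l^{⋊±}` — which acts doubly
transitively [i.e., transitively with stabilizers of order two] on the index set [i.e., `T`]" (p. 168
l.2–7): (a) `g ↦` (index bijection of `g`) is a BIJECTION from the symmetries `Iso(†φ^{Θell}_±, †φ^{Θell}_±)`
onto the finite group `Aut_±(T) ≤ 𝔖(T)`; (b) for every chart `e` of the `𝔽_l^±`-torsor `T` there is a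
group isomorphism `Aut_±(T) ⥲ 𝔽_l^{⋊±}` reading `σ` as `e ∘ σ ∘ e⁻¹` (chart changes conjugate it: a natural
OUTER isomorphism); (c) `Aut_±(T)` acts transitively on `T` with stabilizers of order two.
([IUTchI] Prop 6.8 (i) p.168) [claim: Mochizuki2012, status: disputed] -/
theorem ellBridgeSymmetryGroup_of_equivariant
    (hE : ∀ γ : FlPM l, γ.IsNegative → Ex63.Equivariant K γ) (H : K.DThetaPMEllHT) (hV : Nonempty K.V) :
    Function.Bijective (fun g : DThetaEllBridge.Iso H.ellBridge H.ellBridge =>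
        (⟨(g.indexEquiv : Equiv.Perm H.T), H.ellBridgeIso_indexEquiv_mem_autPM g⟩ :
          H.grpT.toTorsor.autPM)) ∧
      (∀ e ∈ H.grpT.toTorsor.charts, ∃ φ : H.grpT.toTorsor.autPM ≃* FlPM l,
        ∀ (σ : H.grpT.toTorsor.autPM) (t : H.T), e (σ.1 t) = φ σ • e t) ∧
      MulAction.IsPretransitive H.grpT.toTorsor.autPM H.T ∧
      ∀ t : H.T, Nat.card (MulAction.stabilizer H.grpT.toTorsor.autPM t) = 2 := by
  have hl : 2 < l := two_lt_of_nonempty hV H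
  refine ⟨?_, fun e he => H.grpT.toTorsor.exists_mulEquiv_autPM hl he,
    H.grpT.toTorsor.autPM_isPretransitive, H.grpT.toTorsor.card_stabilizer_autPM hl⟩
  -- (a): t13's bijection onto the torsor-compatible self-bijections, which are exactly `Aut_±(T)`
  have hbij : Function.Bijective fun g : DThetaEllBridge.Iso H.ellBridge H.ellBridge =>
      (⟨g.indexEquiv, g.indexEquiv_charts⟩ :
        {ι : H.T ≃ H.T // H.ellBridge.torT.Compat H.ellBridge.torT ι}) :=
    ⟨DThetaEllBridge.isoTorsor_injective hV _ _,
      DThetaEllBridge.isoTorsor_surjective_of_equivariant hE _ _⟩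
  let ε : {ι : H.T ≃ H.T // H.ellBridge.torT.Compat H.ellBridge.torT ι} ≃ H.grpT.toTorsor.autPM :=
    Equiv.subtypeEquiv (Equiv.refl _) fun ι => H.grpT.toTorsor.compat_self_iff_mem_autPM ι
  exact ε.bijective.comp hbij

/-- **Prop 6.8 (i), the count read off the group**: conditionally on `hE`, the symmetries of the
underlying `𝒟-Θ^{ell}`-bridge number exactly `2·l = |𝔽_l^{⋊±}|` (t13's `EllBridgeSymmetry` count `2·|T|` with
`|T| = l`). ([IUTchI] Prop 6.8 (i) p.168) [claim: Mochizuki2012, status: disputed] -/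
theorem card_ellBridgeIso_of_equivariant
    (hE : ∀ γ : FlPM l, γ.IsNegative → Ex63.Equivariant K γ) (H : K.DThetaPMEllHT) (hV : Nonempty K.V) :
    Nat.card (DThetaEllBridge.Iso H.ellBridge H.ellBridge) = 2 * l := by
  have hl : 2 < l := two_lt_of_nonempty hV H
  rw [Nat.card_congr (Equiv.ofBijective _ (ellBridgeSymmetryGroup_of_equivariant hE H hV).1),
    H.grpT.toTorsor.card_autPM hl]

end DThetaPMEllHT

end PMBaseKit

end Literature.IUT.HodgeTheaters
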